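import Summits.ResolutionOfSingularities.ResolutionOfSingularities.Theorems.HomologicalConductorNoZenoSplitGaloisTower

/-!
# Galois splitting base, VI: the package with the finite étale layer exposed; (T-ring) in comap form

W4.4 (crux `NoZenoR`, stmt-ResolutionOfSingularities-19943), slot 5 `stub_L1wCoreF3`, brick
**D2″ (Galois refinement of the splitting base)**, ring side, part 6 (after-care of part 5
`…SplitGaloisTower` on res-L0-w44-stub-2's ASK 2026-08-27T19:38:42Z).

* `exists_galoisGerm₂` — the D2′-currency package of part 5 with the FINITE ÉTALE LAYER
  `D → B → Ŝ = B_𝔫` exposed (`B : Type`, `Algebra ↥D B`, `Algebra B Ŝ`, `IsScalarTower ↥D B Ŝ`,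
  `𝔫 : Ideal B` prime, `IsLocalization.AtPrime Ŝ 𝔫`, `Algebra.FormallyUnramified ↥D B ∧
  Algebra.FiniteType ↥D B`), as needed by the (U)-discharge of BC-4 (`Spec Ŝ → Spec B` a flat
  preimmersion, `Spec B → Spec D` formally unramified of finite type); here `B = integralClosure D L
  = D[α⃗]` (finite étale, part 2).
* `exists_algEquiv_comap_eq_of_isPrime`, `exists_smul_comap_eq_of_isPrime` — (T-ring) of part 5 in
  the `comap` / `MulSemiringAction.toAlgHom` spellings.

Everything is PROVED; no definitions, no named facts. [folklore; the packaging is this work]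

OURS (cell res-hironaka, chain W4.4); AI-written, weaker than expert review; nothing here is a
statement of the manuscript under review; no Theses file is imported.
-/

noncomputable section

set_option linter.dupNamespace false

open Polynomial TensorProduct

namespace Summit.ResolutionOfSingularities.ResolutionOfSingularities.Theorems.NoZeno.SplittingBase

universe u v

/-! ## The package with the finite étale layer `B` exposed (ask of res-L0-w44-stub-2, 19:38:42Z) -/

section D2CurrencyB

open IsLocalRing
open Summit.ResolutionOfSingularities.ResolutionOfSingularities.Theorems.NoZeno.SandwichCluster
open Parasite (locPrime isLocalRing_locPrime)

variable {k K : Type} [Field k] [Field K] [Algebra k K]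

set_option maxHeartbeats 400000 in
/-- **D2″ package, variant exposing the finite étale layer `D → B → Ŝ = B_𝔫`** (for the (U)
discharge of BC-4: `Spec Ŝ → Spec B` is a flat preimmersion (localisation) and `Spec B → Spec D`
is formally unramified of finite type; `Spec Ŝ → Spec D` itself is not of finite type). Same as
`exists_galoisGerm` plus the binders `B`, `Algebra ↥D B`, `Algebra B Ŝ`, `IsScalarTower ↥D B Ŝ`,
`𝔫 : Ideal B` prime, `IsLocalization.AtPrime Ŝ 𝔫` and the conjuncts
`Algebra.FormallyUnramified ↥D B ∧ Algebra.FiniteType ↥D B` (`B = integralClosure D L = D[α⃗]`,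
finite étale by part 2). [folklore; this work for the packaging] -/
theorem exists_galoisGerm₂ (D : Subalgebra k K) [IsLocalRing ↥D] [IsNoetherianRing ↥D]
    [IsIntegrallyClosed ↥D] [IsFractionRing ↥D K] (f : (↥D)[X])
    [Fact (Irreducible (f.map (algebraMap ↥D K)))] (hf : f.Monic)
    (hirr : Irreducible (f.map (residue ↥D))) (hsep : (f.map (residue ↥D)).Separable)
    (hPf : (splitPrime D f).IsPrime) :
    ∃ (Ŝ : Type) (_ : CommRing Ŝ) (_ : IsLocalRing Ŝ) (_ : IsNoetherianRing Ŝ) (_ : IsDomain Ŝ)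
      (_ : IsIntegrallyClosed Ŝ) (_ : Algebra ↥D Ŝ)
      (B : Type) (_ : CommRing B) (_ : Algebra ↥D B) (_ : Algebra B Ŝ) (_ : IsScalarTower ↥D B Ŝ)
      (𝔫 : Ideal B) (_ : 𝔫.IsPrime) (_ : IsLocalization.AtPrime Ŝ 𝔫)
      (_ : Algebra ↥(locPrime (splitModel D f) (splitPrime D f) hPf) Ŝ)
      (_ : IsScalarTower ↥D ↥(locPrime (splitModel D f) (splitPrime D f) hPf) Ŝ)
      (_ : IsLocalHom (algebraMap ↥D Ŝ))
      (_ : IsLocalHom (algebraMap ↥(locPrime (splitModel D f) (splitPrime D f) hPf) Ŝ))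
      (_ : Module.Flat ↥D Ŝ)
      (_ : Module.Flat ↥(locPrime (splitModel D f) (splitPrime D f) hPf) Ŝ)
      (H : Type) (_ : Group H) (_ : Finite H) (ρ : H →* (Ŝ ≃ₐ[↥D] Ŝ)),
      Algebra.FormallyUnramified ↥D B ∧ Algebra.FiniteType ↥D B ∧
      (maximalIdeal ↥D).map (algebraMap ↥D Ŝ) = maximalIdeal Ŝ ∧
      (maximalIdeal ↥(locPrime (splitModel D f) (splitPrime D f) hPf)).map
          (algebraMap ↥(locPrime (splitModel D f) (splitPrime D f) hPf) Ŝ) = maximalIdeal Ŝ ∧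
      FiniteDimensional (ResidueField ↥D) (ResidueField Ŝ) ∧
      IsGalois (ResidueField ↥D) (ResidueField Ŝ) ∧
      Algebra.IsSeparable (ResidueField ↥(locPrime (splitModel D f) (splitPrime D f) hPf))
        (ResidueField Ŝ) ∧
      ringKrullDim Ŝ = ringKrullDim ↥D ∧
      (∀ σ : ResidueField Ŝ ≃ₐ[ResidueField ↥D] ResidueField Ŝ, ∃ h : H, ∀ x : Ŝ,
        residue Ŝ (ρ h x) = σ (residue Ŝ x)) := by
  classical
  -- the splitting field and the integral closure
  let L : Type := (f.map (algebraMap ↥D K)).SplittingField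
  haveI : Polynomial.IsSplittingField K L (f.map (algebraMap ↥D K)) :=
    Polynomial.IsSplittingField.splittingField _
  haveI : FiniteDimensional K L :=
    Polynomial.IsSplittingField.finiteDimensional L (f.map (algebraMap ↥D K))
  obtain ⟨𝔫, h𝔫⟩ := exists_isMaximal_integralClosure (D := ↥D) (L := L)
  -- the finite étale layer `B = integralClosure D L`
  haveI hB : Algebra.Etale ↥D (integralClosure (↥D) L) :=
    etale_integralClosure hf (splits_map_of_isSplittingField (K := K) f) hsep
      (adjoin_rootSet_eq_top_of_isSplittingField (K := K) f)
  haveI hBfin : Module.Finite ↥D (integralClosure (↥D) L) :=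
    finite_integralClosure hf (splits_map_of_isSplittingField (K := K) f) hsep
      (adjoin_rootSet_eq_top_of_isSplittingField (K := K) f)
  have hBunr : Algebra.FormallyUnramified ↥D (integralClosure (↥D) L) := inferInstance
  have hBft : Algebra.FiniteType ↥D (integralClosure (↥D) L) := inferInstance
  have hBtower := isScalarTower_localization_integralClosure (D := ↥D) (L := L) 𝔫
  have hBloc : IsLocalization.AtPrime (Localization.AtPrime 𝔫) 𝔫 := inferInstance
  -- the germ and its bundle over `D`
  haveI hloc := isLocalHom_algebraMap_localization_integralClosure (D := ↥D) (L := L) 𝔫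
  have hflat := flat_localization_integralClosure (K := K) hf hsep 𝔫
  have hm := map_maximalIdeal_localization_integralClosure (K := K) hf hsep 𝔫
  have hfin := finite_residueField_localization_integralClosure (K := K) hf hsep 𝔫
  have hsepR := isSeparable_residueField_localization_integralClosure (K := K) hf hsep 𝔫
  have hnorm := normal_residueField_localization_integralClosure (K := K) hf hsep 𝔫
  have hnoeth := isNoetherianRing_localization_integralClosure (K := K) hf hsep 𝔫
  have hdim := ringKrullDim_localization_integralClosure (K := K) hf hsep 𝔫
  have hic := isIntegrallyClosed_localization_integralClosure (D := ↥D) (K := K) (L := L) 𝔫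
  have hdom : IsDomain (Localization.AtPrime 𝔫) :=
    IsLocalization.isDomain_localization
      (le_nonZeroDivisors_of_noZeroDivisors fun h => h (Ideal.zero_mem 𝔫))
  -- the symmetry
  obtain ⟨H, hH, hHf, ρ, hρ⟩ := exists_group_hom_residue_surjective (K := K) (L := L) hf hsep 𝔫
  -- the tower over the one-root germ `S_f`
  haveI := etale_germ D f hf hirr hsep hPf
  haveI := finite_germ D f hf hirr hPf
  obtain ⟨instA, htower, hlocf, hflatf, hmf, hsepf⟩ :=
    exists_algebra_tower_localization_integralClosure (K := K) (L := L) hf hirr hsep 𝔫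
      (splitGermAlgEquiv D f hf hirr hPf) (map_maximalIdeal_germ D f hf hirr hPf)
  exact ⟨Localization.AtPrime 𝔫, inferInstance, inferInstance, hnoeth, hdom, hic, inferInstance,
    integralClosure (↥D) L, inferInstance, inferInstance, inferInstance, hBtower, 𝔫, inferInstance,
    hBloc, instA, htower, hloc, hlocf, hflat, hflatf, H, hH, hHf, ρ, hBunr, hBft, hm, hmf,
    hfin, isGalois_iff.mpr ⟨hsepR, hnorm⟩, hsepf, hdim, hρ⟩

end D2CurrencyB

section TransitiveComap

variable {κ E : Type u} [Field κ] [Field E] [Algebra κ E] [FiniteDimensional κ E] [IsGalois κ E]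
  {F : Type v} [Field F] [Algebra κ F]

/-- (T-ring), `comap` form: any two primes of `F ⊗_κ E` satisfy `P = Q.comap (1 ⊗ τ)` for some
`τ ∈ Gal(E/κ)`. [folklore] -/
theorem exists_algEquiv_comap_eq_of_isPrime (P Q : Ideal (F ⊗[κ] E)) [P.IsPrime] [Q.IsPrime] :
    ∃ τ : E ≃ₐ[κ] E,
      P = Q.comap (Algebra.TensorProduct.map (AlgHom.id F F) (τ : E →ₐ[κ] E)) := by
  obtain ⟨τ, hτ⟩ := exists_algEquiv_map_eq_of_isPrime (κ := κ) (E := E) (F := F) P Q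
  refine ⟨τ, ?_⟩
  have hbij : Function.Bijective
      (Algebra.TensorProduct.map (AlgHom.id F F) (τ : E →ₐ[κ] E)) :=
    (Algebra.TensorProduct.congr (AlgEquiv.refl : F ≃ₐ[F] F) τ).bijective
  rw [hτ, Ideal.comap_map_of_bijective _ hbij]

/-- (T-ring), `MulSemiringAction.toAlgHom` spelling (the action of `Gal(E/κ)` on `E` by
`AlgEquiv.applyMulSemiringAction`). [folklore] -/
theorem exists_smul_comap_eq_of_isPrime (P Q : Ideal (F ⊗[κ] E)) [P.IsPrime] [Q.IsPrime] :
    ∃ g : E ≃ₐ[κ] E,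
      P = Q.comap (Algebra.TensorProduct.map (AlgHom.id F F)
        (MulSemiringAction.toAlgHom κ E g)) := by
  obtain ⟨τ, hτ⟩ := exists_algEquiv_comap_eq_of_isPrime (κ := κ) (E := E) (F := F) P Q
  refine ⟨τ, ?_⟩
  have h : MulSemiringAction.toAlgHom κ E τ = (τ : E →ₐ[κ] E) := by
    ext x; rfl
  rw [h]; exact hτ

end TransitiveComap

end Summit.ResolutionOfSingularities.ResolutionOfSingularities.Theorems.NoZeno.SplittingBase

end
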